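import Mathlib
import Summits.Ventures.HodgeRepro.Tier4.Common.TargetDataV3

/-!
# Tier4/Common/RelevelDescent — transport lemmas for the re-levelled datum, the descent of N2 to deeper levels, and
`P_T4v3` from the `P_T4`-shaped conclusion of a re-levelled datum

Blind re-derivation cell `pub-hodge-repro`, Tier 4 (README §9–§10), seat t4-typer-1 (gen 2).  Target tree path
`lean/Summits/Ventures/HodgeRepro/Tier4/Common/RelevelDescent.lean`.  Imports `Tier4/Common/TargetDataV3.lean` (typer-1 g1,
p690442: `TargetData.relevel`, `TargetData.N2`, `TargetData.conclusionAt`, `P_T4v3_of_forall`) and nothing else of Tier 4.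

WHAT IS TYPED (glue only; every proof is by unfolding or by `rfl`).
* **Transport**: the re-levelled datum `d.relevel Γ' hΓ' a' ha'` keeps every field of `d` except the level and the lifts
  (`relevel_T`, `relevel_H`, `relevel_τ₀`, `relevel_C`, `relevel_s`, `relevel_Λ`, `relevel_i₁` … — all `rfl`), so its
  predicates are `d`'s: `relevel_isLevel_iff`, `relevel_isHeckeFor_iff`, `relevel_isDomain_iff`, `relevel_isCocompact_iff`,
  `relevel_act`; re-levelling twice is re-levelling once (`relevel_relevel`), re-levelling to the datum's own level and lifts
  is the identity (`relevel_self`, structure eta).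
* **Descent of N2** (`TargetData.N2.descend`): at a deeper level `Γ'' ⊆ Γ'` fewer `N` are admissible
  (`Γ(N) ⊆ Γ'' ⊆ Γ'`), the lifts and the corners unchanged — so `N2` at `(Γ', a')` gives `N2` at `(Γ'', a')`;
  `N2.descend_self` is the case `Γ' = d.Γ`, `a' = d.a`.  (The same one-line argument is the glue `TargetData.N2.mono`
  inside Line L1's skeleton v0.41, L1858; typed here once for every line, under a different name so that a skeleton
  holding its own copy can import this module without an ambiguity.)
* **`P_T4v3` from a `P_T4`-shaped conclusion at a re-levelled datum** (`exists_conclusionAt_of_conclusion`,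
  `P_T4v3_of_forall_conclusion`): a line that produces, for every datum, a level `Γ'`, N2-lifts `a'` at `Γ'` and the
  `P_T4`-conclusion of `d.relevel Γ' _ a' _` (which carries its OWN deeper level `Γ'' ⊆ Γ'` with Hecke elements and a domain)
  closes `P_T4v3`: the lifts descend to `Γ''` (`IsAlbaneseLift.mono`, TargetV3 J6), N2 descends (`N2.descend`), and the
  conclusion IS `conclusionAt Γ''` of the datum re-levelled to `Γ''`.
* **`P_T4v3` from `P_T4` and N2 at the given data** (`P_T4v3_of_P_T4_of_N2`): `P_T4` (the frozen target — refuted on paper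
  in the Tier-4 record, kept here only as a hypothesis shape) together with `N2` at every datum's OWN level and lifts gives
  `P_T4v3` with `a' := a` — the formal content of «v3 is `P_T4` with the N2 restriction made a conjunct of the witness».

Nothing here says anything about the status of the Hodge conjecture for CM abelian varieties, which is NOT proved
(HC_CM is NOT proved by anyone in this repository).
-/

set_option autoImplicit false

noncomputable section

open Matrix MeasureTheory NumberField Set
open scoped ComplexConjugate ComplexOrder

namespace Summit.Ventures.HodgeRepro.Tier4

open Summit.Ventures.HodgeRepro.Tier4.Common

namespace TargetData

variable {F E : Type} [Field F] [NumberField F] [IsGalois ℚ F] [IsCMField F]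
  [Field E] [NumberField E] [IsGalois ℚ E] [IsCMField E] (d : TargetData F E)

section Transport

variable {Γ' : Set (Matrix (Fin 3) (Fin 3) E)} (hΓ' : IsCongruenceSubgroup (IsCMField.complexConj E).toRingEquiv d.H Γ')
  (a' : ∀ i : Fin 4, (Fin 2 → ℂ) → (↥(d.T i) → ℂ)) (ha' : ∀ i, IsAlbaneseLift (d.T i) (d.Λ i) d.τ₀ d.C Γ' (a' i))

/-- The re-levelled datum has the tori of `d`. -/
@[simp] theorem relevel_T : (d.relevel Γ' hΓ' a' ha').T = d.T := rfl

/-- The re-levelled datum has the hermitian matrix of `d`. -/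
@[simp] theorem relevel_H : (d.relevel Γ' hΓ' a' ha').H = d.H := rfl

/-- The re-levelled datum has the distinguished embedding `τ₀` of `d`. -/
@[simp] theorem relevel_τ₀ : (d.relevel Γ' hΓ' a' ha').τ₀ = d.τ₀ := rfl

/-- The re-levelled datum has the Sylvester matrix `C` of `d`. -/
@[simp] theorem relevel_C : (d.relevel Γ' hΓ' a' ha').C = d.C := rfl

/-- The re-levelled datum has the level `Γ'` it was re-levelled to. -/
@[simp] theorem relevel_Γ : (d.relevel Γ' hΓ' a' ha').Γ = Γ' := rfl

/-- The re-levelled datum has the embedding `s` of `d`. -/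
@[simp] theorem relevel_s : (d.relevel Γ' hΓ' a' ha').s = d.s := rfl

/-- The re-levelled datum has the lattices of `d`. -/
@[simp] theorem relevel_Λ : (d.relevel Γ' hΓ' a' ha').Λ = d.Λ := rfl

/-- The re-levelled datum has the lifts `a'` it was re-levelled to. -/
@[simp] theorem relevel_a : (d.relevel Γ' hΓ' a' ha').a = a' := rfl

/-- The re-levelled datum has the index `i₁` of `d`. -/
@[simp] theorem relevel_i₁ : (d.relevel Γ' hΓ' a' ha').i₁ = d.i₁ := rfl

/-- The re-levelled datum has the index `i₂` of `d`. -/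
@[simp] theorem relevel_i₂ : (d.relevel Γ' hΓ' a' ha').i₂ = d.i₂ := rfl

/-- The re-levelled datum has the index `i₃` of `d`. -/
@[simp] theorem relevel_i₃ : (d.relevel Γ' hΓ' a' ha').i₃ = d.i₃ := rfl

/-- The re-levelled datum has the index `i₄` of `d`. -/
@[simp] theorem relevel_i₄ : (d.relevel Γ' hΓ' a' ha').i₄ = d.i₄ := rfl

/-- The ball action of the re-levelled datum is the ball action of `d`. -/
@[simp] theorem relevel_act : (d.relevel Γ' hΓ' a' ha').act = d.act := rfl

/-- A level of the re-levelled datum is a congruence subgroup of `U(H)` inside `Γ'`. -/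
theorem relevel_isLevel_iff (Γ'' : Set (Matrix (Fin 3) (Fin 3) E)) :
    (d.relevel Γ' hΓ' a' ha').IsLevel Γ'' ↔
      IsCongruenceSubgroup (IsCMField.complexConj E).toRingEquiv d.H Γ'' ∧ Γ'' ⊆ Γ' :=
  Iff.rfl

/-- Hecke elements of level `Γ''` for the re-levelled datum are Hecke elements of level `Γ''` for `d`. -/
theorem relevel_isHeckeFor_iff (Γ'' : Set (Matrix (Fin 3) (Fin 3) E)) (h : Fin 4 → HeckeElement E) :
    (d.relevel Γ' hΓ' a' ha').IsHeckeFor Γ'' h ↔ d.IsHeckeFor Γ'' h :=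
  Iff.rfl

/-- A fundamental domain of `Γ''` for the re-levelled datum is one for `d`. -/
theorem relevel_isDomain_iff (Γ'' : Set (Matrix (Fin 3) (Fin 3) E)) (D : Set (Fin 2 → ℂ)) :
    (d.relevel Γ' hΓ' a' ha').IsDomain Γ'' D ↔ d.IsDomain Γ'' D :=
  Iff.rfl

/-- Cocompactness of a level for the re-levelled datum is cocompactness for `d`. -/
theorem relevel_isCocompact_iff (Γ'' : Set (Matrix (Fin 3) (Fin 3) E)) :
    (d.relevel Γ' hΓ' a' ha').IsCocompact Γ'' ↔ d.IsCocompact Γ'' :=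
  Iff.rfl

/-- Re-levelling twice is re-levelling once (to the second level and lifts). -/
theorem relevel_relevel {Γ'' : Set (Matrix (Fin 3) (Fin 3) E)}
    (hΓ'' : IsCongruenceSubgroup (IsCMField.complexConj E).toRingEquiv d.H Γ'')
    (a'' : ∀ i : Fin 4, (Fin 2 → ℂ) → (↥(d.T i) → ℂ)) (ha'' : ∀ i, IsAlbaneseLift (d.T i) (d.Λ i) d.τ₀ d.C Γ'' (a'' i)) :
    (d.relevel Γ' hΓ' a' ha').relevel Γ'' hΓ'' a'' ha'' = d.relevel Γ'' hΓ'' a'' ha'' :=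
  rfl

end Transport

/-- Re-levelling to the datum's own level and lifts is the identity (structure eta). -/
theorem relevel_self : d.relevel d.Γ d.hΓ d.a d.ha = d := rfl

/-- The datum's own level is a level of the datum (`d.isLevel_self`), with the congruence half `d.hΓ`. -/
theorem isLevel_self_fst : d.isLevel_self.1 = d.hΓ := rfl

/-- **N2 DESCENDS TO DEEPER LEVELS**: at `Γ'' ⊆ Γ'` fewer `N` are admissible (`Γ(N) ⊆ Γ'' ⊆ Γ'`); the lifts `a'` and the
corners are unchanged. -/
theorem N2.descend {Γ' Γ'' : Set (Matrix (Fin 3) (Fin 3) E)}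
    (hΓ' : IsCongruenceSubgroup (IsCMField.complexConj E).toRingEquiv d.H Γ')
    (hΓ'' : IsCongruenceSubgroup (IsCMField.complexConj E).toRingEquiv d.H Γ'')
    (a' : ∀ i : Fin 4, (Fin 2 → ℂ) → (↥(d.T i) → ℂ)) (ha' : ∀ i, IsAlbaneseLift (d.T i) (d.Λ i) d.τ₀ d.C Γ' (a' i))
    (ha'' : ∀ i, IsAlbaneseLift (d.T i) (d.Λ i) d.τ₀ d.C Γ'' (a' i)) (hsub : Γ'' ⊆ Γ')
    (h : (d.relevel Γ' hΓ' a' ha').N2) : (d.relevel Γ'' hΓ'' a' ha'').N2 :=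
  fun N hN hsub' γ hγ => h N hN (hsub'.trans hsub) γ hγ

/-- **N2 at the datum's own level and lifts descends to every deeper level** (with the same lifts, which descend by
`IsAlbaneseLift.mono`). -/
theorem N2.descend_self {Γ' : Set (Matrix (Fin 3) (Fin 3) E)} (hΓ' : d.IsLevel Γ') (h : d.N2) :
    (d.relevel Γ' hΓ'.1 d.a fun i => (d.ha i).mono hΓ'.2).N2 :=
  fun N hN hsub' γ hγ => h N hN (hsub'.trans hΓ'.2) γ hγ

/-- **A `P_T4`-shaped conclusion of the re-levelled datum gives `conclusionAt` at its own deeper level, with N2**: the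
conclusion of `d.relevel Γ' _ a' _` carries a level `Γ'' ⊆ Γ'`, Hecke elements of level `Γ''` and a domain of `Γ''` with
non-zero pairing; the lifts and N2 descend to `Γ''`. -/
theorem exists_conclusionAt_of_conclusion {Γ' : Set (Matrix (Fin 3) (Fin 3) E)} (hΓ' : d.IsLevel Γ')
    (a' : ∀ i : Fin 4, (Fin 2 → ℂ) → (↥(d.T i) → ℂ)) (ha' : ∀ i, IsAlbaneseLift (d.T i) (d.Λ i) d.τ₀ d.C Γ' (a' i))
    (hN2 : (d.relevel Γ' hΓ'.1 a' ha').N2) (hc : (d.relevel Γ' hΓ'.1 a' ha').conclusion) :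
    ∃ (Γ'' : Set (Matrix (Fin 3) (Fin 3) E)) (hΓ'' : d.IsLevel Γ'')
      (ha'' : ∀ i, IsAlbaneseLift (d.T i) (d.Λ i) d.τ₀ d.C Γ'' (a' i)),
      (d.relevel Γ'' hΓ''.1 a' ha'').N2 ∧ (d.relevel Γ'' hΓ''.1 a' ha'').conclusionAt Γ'' := by
  obtain ⟨Γ'', hΓ''c, hsub, h, hh, D, hD, hne⟩ := hc
  exact ⟨Γ'', ⟨hΓ''c, hsub.trans hΓ'.2⟩, fun i => (ha' i).mono hsub,
    TargetData.N2.descend d hΓ'.1 hΓ''c a' ha' (fun i => (ha' i).mono hsub) hsub hN2, h, hh, D, hD, hne⟩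

end TargetData

/-- **`P_T4v3` from a `P_T4`-shaped conclusion at a re-levelled datum**: if every datum has a level `Γ'`, N2-lifts `a'` at
`Γ'` and the `P_T4`-conclusion of `d.relevel Γ' _ a' _`, then `P_T4v3` (the witness is the conclusion's own deeper level
`Γ''`, to which the lifts and N2 descend). -/
theorem P_T4v3_of_forall_conclusion
    (h : ∀ (F E : Type) [Field F] [NumberField F] [IsGalois ℚ F] [IsCMField F]
      [Field E] [NumberField E] [IsGalois ℚ E] [IsCMField E] (d : TargetData F E),
      ∃ (Γ' : Set (Matrix (Fin 3) (Fin 3) E)) (hΓ' : d.IsLevel Γ') (a' : ∀ i : Fin 4, (Fin 2 → ℂ) → (↥(d.T i) → ℂ))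
        (ha' : ∀ i, IsAlbaneseLift (d.T i) (d.Λ i) d.τ₀ d.C Γ' (a' i)),
        (d.relevel Γ' hΓ'.1 a' ha').N2 ∧ (d.relevel Γ' hΓ'.1 a' ha').conclusion) :
    P_T4v3 := by
  refine P_T4v3_of_forall fun F E _ _ _ _ _ _ _ _ d => ?_
  obtain ⟨Γ', hΓ', a', ha', hN2, hc⟩ := h F E d
  obtain ⟨Γ'', hΓ'', ha'', hN2'', hcat⟩ := d.exists_conclusionAt_of_conclusion hΓ' a' ha' hN2 hc
  exact ⟨Γ'', hΓ'', a', ha'', hN2'', hcat⟩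

/-- **`P_T4v3` from `P_T4` together with N2 at every datum's own level and lifts** (`a' := a`): the formal content of «the
successor target is `P_T4` with the N2 restriction made a conjunct of the witness».  (`P_T4` is the frozen target, refuted
on paper in the Tier-4 record; it appears here only as a hypothesis shape.) -/
theorem P_T4v3_of_P_T4_of_N2 (h : P_T4)
    (hN2 : ∀ (F E : Type) [Field F] [NumberField F] [IsGalois ℚ F] [IsCMField F]
      [Field E] [NumberField E] [IsGalois ℚ E] [IsCMField E] (d : TargetData F E), d.N2) :
    P_T4v3 := by
  refine P_T4v3_of_forall_conclusion fun F E _ _ _ _ _ _ _ _ d => ?_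
  exact ⟨d.Γ, d.isLevel_self, d.a, d.ha, hN2 F E d, P_T4_iff_forall.1 h F E d⟩

end Summit.Ventures.HodgeRepro.Tier4
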